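import Literature.Probability.LatticeModels.StrongHarrisKleitman
import HarnessLib

/-!
# Kernel rows: positivity of chain-positive submodular quadratic forms on monotone images of product measures

Helper file for crux `stmt-CriticalPhenomena-4575` (`NoHeavyLowerTail`), new-inequality factory seat
`prim-ineq-gen-1` (gen 2).  Everything here is PROVED.

**Theorem (`prodBernoulli_kernelRow`).**  Let `Q` be a finite preorder, `κ : Q → Q → ℝ` a kernel with
`0 ≤ κ x x` for all `x` and the *submodularity on comparable rectangles*
`κ a₁ b₁ + κ a₀ b₀ ≤ κ a₁ b₀ + κ a₀ b₁` whenever `a₀ ≤ a₁`, `b₀ ≤ b₁`.  Let `μ = prodBernoulli p` on `Set ι`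
(`ι` finite) and `λ : Set ι → Q` monotone (`ω ⊆ ω' → λ ω ≤ λ ω'`).  Then, with `m x = μ(λ = x)`,
`0 ≤ Σ_{x,y} κ(x,y) m(x) m(y)`.

Examples. `Q` = set partitions of a set of terminals ordered by coarsening, `λ(ω)` = the partition into open
clusters of a bond configuration (more open edges = coarser): every such kernel is a valid quadratic "row"
for the 15-cell and 52-cell laws of the wf3lp certificate lane.  Harris' inequality (`κ(x,y) = 1_{U∩U'}(y) −
1_U(x)1_{U'}(y)`) and Gladkov's strong Harris inequality (`Q = {B < Cᵢ < A}`, `κ(A,B) = κ(B,A) = 1`,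
`κ(Cᵢ,Cⱼ) = −1`) are the simplest members of this polyhedral cone.

Proof (Gladkov's scheme, one coordinate at a time).  Split along a coordinate `e`: `m = t m¹ + (1−t) m⁰`
(`t = p_e`; `m¹, m⁰` the laws of the sections `λ(· ∪ {e})`, `λ(· ∖ {e})`, monotone, determined by fewer
coordinates, so `f(mˢ) ≥ 0` by induction).  The quadratic form along the segment is
`(1−t) f(m⁰) + t f(m¹) + (t² − t) f(Δ)`, `Δ = m¹ − m⁰`, and `f(Δ) ≤ 0`: writing `Δ = Σ_{u ≤ v} τ(u,v)(δ_v − δ_u)`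
with the transition masses `τ(u,v) = μ(λ⁰ = u, λ¹ = v) ≥ 0` (only `u ≤ v` occurs, by monotonicity), `f(Δ)`
is a nonnegative combination of `κ(v,v') − κ(v,u') − κ(u,v') + κ(u,u') ≤ 0`.  The base case is `κ(x,x) ≥ 0`.
-/

noncomputable section

namespace Summit.CriticalPhenomena.PercolationContinuityZ3.Theorems

namespace KernelRows

open MeasureTheory Finset Literature.Probability.LatticeModels Literature.Probability.Percolation
open Literature.Probability.LatticeModels.StrongHarris

variable {ι : Type*} {Q : Type*} [Fintype Q]

/-! ### The bilinear form of a kernel -/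

/-- The bilinear form `f ↦ Σ_{x,y} κ(x,y) f(x) g(y)` of a kernel `κ` on a finite type. -/
def qform (κ : Q → Q → ℝ) (f g : Q → ℝ) : ℝ := ∑ x, ∑ y, κ x y * (f x * g y)

variable (κ : Q → Q → ℝ)

/-- Additivity of `qform` in the first argument. -/
theorem qform_add_left (f f' g : Q → ℝ) : qform κ (f + f') g = qform κ f g + qform κ f' g := by
  simp only [qform, Pi.add_apply, ← sum_add_distrib]
  exact sum_congr rfl fun x _ => sum_congr rfl fun y _ => by ring

/-- Additivity of `qform` in the second argument. -/
theorem qform_add_right (f g g' : Q → ℝ) : qform κ f (g + g') = qform κ f g + qform κ f g' := by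
  simp only [qform, Pi.add_apply, ← sum_add_distrib]
  exact sum_congr rfl fun x _ => sum_congr rfl fun y _ => by ring

/-- Homogeneity of `qform` in the first argument. -/
theorem qform_smul_left (c : ℝ) (f g : Q → ℝ) : qform κ (c • f) g = c * qform κ f g := by
  simp only [qform, Pi.smul_apply, smul_eq_mul, mul_sum]
  exact sum_congr rfl fun x _ => sum_congr rfl fun y _ => by ring

/-- Homogeneity of `qform` in the second argument. -/
theorem qform_smul_right (c : ℝ) (f g : Q → ℝ) : qform κ f (c • g) = c * qform κ f g := by
  simp only [qform, Pi.smul_apply, smul_eq_mul, mul_sum]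
  exact sum_congr rfl fun x _ => sum_congr rfl fun y _ => by ring

/-- Negation in the first argument. -/
theorem qform_neg_left (f g : Q → ℝ) : qform κ (-f) g = -qform κ f g := by
  have := qform_smul_left κ (-1) f g
  simpa using this

/-- Negation in the second argument. -/
theorem qform_neg_right (f g : Q → ℝ) : qform κ f (-g) = -qform κ f g := by
  have := qform_smul_right κ (-1) f g
  simpa using this

/-- `qform` of a finite linear combination in the first argument. -/
theorem qform_sum_left {β : Type*} (s : Finset β) (f : β → Q → ℝ) (g : Q → ℝ) :
    qform κ (fun x => ∑ i ∈ s, f i x) g = ∑ i ∈ s, qform κ (f i) g := by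
  classical
  induction s using Finset.induction_on with
  | empty =>
    simp [qform]
  | insert a s ha ih =>
    rw [sum_insert ha, ← ih, ← qform_add_left]
    congr 1
    ext x
    simp [sum_insert ha]

/-- `qform` of a finite linear combination in the second argument. -/
theorem qform_sum_right {β : Type*} (s : Finset β) (f : Q → ℝ) (g : β → Q → ℝ) :
    qform κ f (fun x => ∑ i ∈ s, g i x) = ∑ i ∈ s, qform κ f (g i) := by
  classical
  induction s using Finset.induction_on with
  | empty =>
    simp [qform]
  | insert a s ha ih =>
    rw [sum_insert ha, ← ih, ← qform_add_right]
    congr 1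
    ext x
    simp [sum_insert ha]

/-- `qform` on indicator functions of points recovers the kernel entry. -/
theorem qform_single [DecidableEq Q] (u v : Q) : qform κ (Pi.single u 1) (Pi.single v 1) = κ u v := by
  simp only [qform, Pi.single_apply]
  rw [sum_eq_single u, sum_eq_single v]
  · simp
  · intro y _ hy; simp [hy]
  · simp
  · intro x _ hx; simp [hx]
  · simp

/-- The value of `qform` on a difference of two point indicators ("one transition"). -/
theorem qform_transition [DecidableEq Q] (u v u' v' : Q) :
    qform κ (Pi.single v 1 - Pi.single u 1) (Pi.single v' 1 - Pi.single u' 1) =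
      κ v v' - κ v u' - κ u v' + κ u u' := by
  rw [sub_eq_add_neg, sub_eq_add_neg, qform_add_left, qform_add_right, qform_add_right,
    qform_neg_left, qform_neg_left, qform_neg_right, qform_neg_right, qform_single, qform_single,
    qform_single, qform_single]
  ring

/-- Expansion of the quadratic form along a segment: with `D = g₁ − g₀`,
`f(g₀ + t D) = (1 − t) f(g₀) + t f(g₁) + (t² − t) f(D)`. -/
theorem qform_segment (g₀ g₁ : Q → ℝ) (t : ℝ) :
    qform κ (g₀ + t • (g₁ - g₀)) (g₀ + t • (g₁ - g₀)) =
      (1 - t) * qform κ g₀ g₀ + t * qform κ g₁ g₁ + (t ^ 2 - t) * qform κ (g₁ - g₀) (g₁ - g₀) := by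
  have e1 : g₁ = g₀ + (g₁ - g₀) := by abel
  set D := g₁ - g₀ with hD
  rw [e1]
  simp only [qform_add_left, qform_add_right, qform_smul_left, qform_smul_right]
  ring

/-- **The transition lemma.**  If `Δ(x) = Σ_u τ(u,x) − Σ_v τ(x,v)` with `τ ≥ 0` supported on comparable
pairs `u ≤ v`, and `κ` is submodular on comparable rectangles, then `qform κ Δ Δ ≤ 0`. -/
theorem qform_transition_nonpos [DecidableEq Q] [Preorder Q]
    (hsub : ∀ a₀ a₁ b₀ b₁ : Q, a₀ ≤ a₁ → b₀ ≤ b₁ → κ a₁ b₁ + κ a₀ b₀ ≤ κ a₁ b₀ + κ a₀ b₁)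
    (τ : Q → Q → ℝ) (hτ : ∀ u v, 0 ≤ τ u v) (hτle : ∀ u v, τ u v ≠ 0 → u ≤ v) :
    qform κ (fun x => ∑ u, τ u x - ∑ v, τ x v) (fun x => ∑ u, τ u x - ∑ v, τ x v) ≤ 0 := by
  -- rewrite `Δ` as a combination of transitions
  have hΔ : (fun x => ∑ u, τ u x - ∑ v, τ x v) =
      fun x => ∑ u, ∑ v, τ u v * ((Pi.single v (1 : ℝ) : Q → ℝ) x - (Pi.single u (1 : ℝ) : Q → ℝ) x) := by
    ext x
    have h1 : ∑ u, ∑ v, τ u v * (Pi.single v (1 : ℝ) : Q → ℝ) x = ∑ u, τ u x := by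
      refine sum_congr rfl fun u _ => ?_
      simp only [Pi.single_apply, mul_ite, mul_one, mul_zero, sum_ite_eq, mem_univ, if_true]
    have h2 : ∑ u, ∑ v, τ u v * (Pi.single u (1 : ℝ) : Q → ℝ) x = ∑ v, τ x v := by
      rw [sum_comm]
      refine sum_congr rfl fun v _ => ?_
      simp only [Pi.single_apply, mul_ite, mul_one, mul_zero, sum_ite_eq, mem_univ, if_true]
    simp only [mul_sub, sum_sub_distrib]
    rw [h1, h2]
  rw [hΔ]
  have step1 : qform κ
      (fun x => ∑ u, ∑ v, τ u v * ((Pi.single v (1 : ℝ) : Q → ℝ) x - (Pi.single u (1 : ℝ) : Q → ℝ) x))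
      (fun x => ∑ u, ∑ v, τ u v * ((Pi.single v (1 : ℝ) : Q → ℝ) x - (Pi.single u (1 : ℝ) : Q → ℝ) x)) =
      ∑ u, ∑ v, ∑ u', ∑ v', τ u v * τ u' v' *
        (κ v v' - κ v u' - κ u v' + κ u u') := by
    rw [qform_sum_left]
    refine sum_congr rfl fun u _ => ?_
    rw [qform_sum_left]
    refine sum_congr rfl fun v _ => ?_
    have : (fun x => τ u v * ((Pi.single v (1 : ℝ) : Q → ℝ) x - (Pi.single u (1 : ℝ) : Q → ℝ) x)) =
        τ u v • ((Pi.single v (1 : ℝ) : Q → ℝ) - Pi.single u 1) := by ext x; simp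
    rw [this, qform_smul_left, qform_sum_right, mul_sum]
    refine sum_congr rfl fun u' _ => ?_
    rw [qform_sum_right, mul_sum]
    refine sum_congr rfl fun v' _ => ?_
    have : (fun x => τ u' v' * ((Pi.single v' (1 : ℝ) : Q → ℝ) x - (Pi.single u' (1 : ℝ) : Q → ℝ) x)) =
        τ u' v' • ((Pi.single v' (1 : ℝ) : Q → ℝ) - Pi.single u' 1) := by ext x; simp
    rw [this, qform_smul_right, qform_transition]
    ring
  rw [step1]
  refine sum_nonpos fun u _ => sum_nonpos fun v _ => sum_nonpos fun u' _ => sum_nonpos fun v' _ => ?_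
  by_cases h1 : τ u v = 0
  · simp [h1]
  by_cases h2 : τ u' v' = 0
  · simp [h2]
  have hs := hsub u v u' v' (hτle u v h1) (hτle u' v' h2)
  have hnn : 0 ≤ τ u v * τ u' v' := mul_nonneg (hτ u v) (hτ u' v')
  have : κ v v' - κ v u' - κ u v' + κ u u' ≤ 0 := by linarith
  exact mul_nonpos_of_nonneg_of_nonpos hnn this

/-! ### The measure-theoretic statement -/

/-- **Kernel rows for cylinder statistics.**  For `μ = prodBernoulli p` on `Set ι` and a monotone statistic
`λ : Set ι → Q` whose fibres are determined by the finite coordinate set `F`, every kernel `κ` with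
nonnegative diagonal that is submodular on comparable rectangles satisfies
`0 ≤ Σ_{x,y} κ(x,y) μ(λ = x) μ(λ = y)`. [new] -/
theorem prodBernoulli_kernelRow_of_determinedBy [DecidableEq Q] [Preorder Q] (p : ι → unitInterval)
    (hdiag : ∀ x, 0 ≤ κ x x)
    (hsub : ∀ a₀ a₁ b₀ b₁ : Q, a₀ ≤ a₁ → b₀ ≤ b₁ → κ a₁ b₁ + κ a₀ b₀ ≤ κ a₁ b₀ + κ a₀ b₁)
    (F : Finset ι) :
    ∀ lam : Set ι → Q, (∀ ⦃ω ω' : Set ι⦄, ω ⊆ ω' → lam ω ≤ lam ω') →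
      (∀ q, DeterminedBy (lam ⁻¹' {q}) (↑F : Set ι)) →
      0 ≤ qform κ (fun x => (prodBernoulli p).real (lam ⁻¹' {x}))
        (fun x => (prodBernoulli p).real (lam ⁻¹' {x})) := by
  classical
  induction F using Finset.induction_on with
  | empty =>
    intro lam _ hdet
    -- every fibre is `∅` or `univ`: `lam` is constant
    have hconst : ∀ ω, lam ω = lam ∅ := by
      intro ω
      have h := (determinedBy_iff _ _).1 (hdet (lam ∅)) ∅ ω (by simp)
      simpa using h
    have hm : (fun x => (prodBernoulli p).real (lam ⁻¹' {x})) = Pi.single (lam ∅) (1 : ℝ) := by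
      ext x
      by_cases hx : x = lam ∅
      · subst hx
        have : lam ⁻¹' {lam ∅} = Set.univ := by
          ext ω; simp [hconst ω]
        rw [this]; simp
      · have : lam ⁻¹' {x} = ∅ := by
          ext ω; simp only [Set.mem_preimage, Set.mem_singleton_iff, Set.mem_empty_iff_false,
            iff_false]; rw [hconst ω]; exact Ne.symm hx
        rw [this]; simp [hx]
    rw [hm, qform_single]
    exact hdiag _
  | insert e F' he ih =>
    intro lam hmono hdet
    set μ := prodBernoulli p with hμ
    -- the two sections
    set lam1 : Set ι → Q := fun ω => lam (insert e ω) with hlam1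
    set lam0 : Set ι → Q := fun ω => lam (ω \ {e}) with hlam0
    have hmono1 : ∀ ⦃ω ω' : Set ι⦄, ω ⊆ ω' → lam1 ω ≤ lam1 ω' :=
      fun ω ω' h => hmono (Set.insert_subset_insert h)
    have hmono0 : ∀ ⦃ω ω' : Set ι⦄, ω ⊆ ω' → lam0 ω ≤ lam0 ω' :=
      fun ω ω' h => hmono fun x hx => ⟨h hx.1, hx.2⟩
    have hdet1 : ∀ q, DeterminedBy (lam1 ⁻¹' {q}) (↑F' : Set ι) :=
      fun q => determinedBy_preimage_insert (hdet q)
    have hdet0 : ∀ q, DeterminedBy (lam0 ⁻¹' {q}) (↑F' : Set ι) :=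
      fun q => determinedBy_preimage_sdiff (hdet q)
    set m1 : Q → ℝ := fun x => μ.real (lam1 ⁻¹' {x}) with hm1
    set m0 : Q → ℝ := fun x => μ.real (lam0 ⁻¹' {x}) with hm0
    have ih1 : 0 ≤ qform κ m1 m1 := ih lam1 hmono1 hdet1
    have ih0 : 0 ≤ qform κ m0 m0 := ih lam0 hmono0 hdet0
    -- decomposition along `e`
    set t : ℝ := (p e : ℝ) with ht
    have ht0 : 0 ≤ t := (p e).2.1
    have ht1 : t ≤ 1 := (p e).2.2
    have hdec : (fun x => μ.real (lam ⁻¹' {x})) = m0 + t • (m1 - m0) := by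
      ext x
      have := real_eq_preimage_insert_add_preimage_sdiff p e (hdet x)
      simp only [Pi.add_apply, Pi.smul_apply, Pi.sub_apply, smul_eq_mul, hm0, hm1, hlam0, hlam1]
      rw [hμ] at *
      rw [this]
      simp only [Set.preimage_preimage]
      ring
    -- transition masses
    set τ : Q → Q → ℝ := fun u v => μ.real (lam0 ⁻¹' {u} ∩ lam1 ⁻¹' {v}) with hτ
    have hmeas : ∀ u v, MeasurableSet (lam0 ⁻¹' {u} ∩ lam1 ⁻¹' {v}) := fun u v =>
      ((hdet0 u).measurableSet_of_finset).inter ((hdet1 v).measurableSet_of_finset)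
    have hτnn : ∀ u v, 0 ≤ τ u v := fun u v => measureReal_nonneg
    have hτle : ∀ u v, τ u v ≠ 0 → u ≤ v := by
      intro u v hne
      by_contra hle
      apply hne
      have : lam0 ⁻¹' {u} ∩ lam1 ⁻¹' {v} = ∅ := by
        ext ω
        simp only [Set.mem_inter_iff, Set.mem_preimage, Set.mem_singleton_iff,
          Set.mem_empty_iff_false, iff_false, not_and]
        intro hu hv
        apply hle
        rw [← hu, ← hv]
        exact hmono fun x hx => Set.mem_insert_of_mem _ hx.1
      simp [hτ, this]
    -- fibre decompositions `m0 u = Σ_v τ u v`, `m1 v = Σ_u τ u v`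
    set pr : Set ι → Q × Q := fun ω => (lam0 ω, lam1 ω) with hpr
    have hfib : ∀ z : Q × Q, pr ⁻¹' {z} = lam0 ⁻¹' {z.1} ∩ lam1 ⁻¹' {z.2} := by
      intro z; ext ω; simp [hpr, Prod.ext_iff]
    have hm0sum : ∀ u, m0 u = ∑ v, τ u v := by
      intro u
      have hs := sum_measureReal_preimage_singleton (μ := μ) ({u} ×ˢ (univ : Finset Q))
        (f := pr) (fun z _ => by rw [hfib]; exact hmeas _ _)
      rw [sum_product] at hs
      simp only [sum_singleton] at hs
      have e1 : pr ⁻¹' (↑({u} ×ˢ (univ : Finset Q)) : Set (Q × Q)) = lam0 ⁻¹' {u} := by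
        ext ω; simp [hpr, eq_comm]
      rw [e1] at hs
      rw [hm0]
      simp only
      rw [← hs]
      exact sum_congr rfl fun v _ => by rw [hfib]
    have hm1sum : ∀ v, m1 v = ∑ u, τ u v := by
      intro v
      have hs := sum_measureReal_preimage_singleton (μ := μ) ((univ : Finset Q) ×ˢ {v})
        (f := pr) (fun z _ => by rw [hfib]; exact hmeas _ _)
      rw [sum_product] at hs
      simp only [sum_singleton] at hs
      have e1 : pr ⁻¹' (↑((univ : Finset Q) ×ˢ {v}) : Set (Q × Q)) = lam1 ⁻¹' {v} := by
        ext ω; simp [hpr, eq_comm]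
      rw [e1] at hs
      rw [hm1]
      simp only
      rw [← hs]
      exact sum_congr rfl fun u _ => by rw [hfib]
    have hΔ : m1 - m0 = fun x => ∑ u, τ u x - ∑ v, τ x v := by
      ext x; simp only [Pi.sub_apply]; rw [hm1sum, hm0sum]
    have hneg : qform κ (m1 - m0) (m1 - m0) ≤ 0 := by
      rw [hΔ]; exact qform_transition_nonpos κ hsub τ hτnn hτle
    rw [hdec, qform_segment]
    have h1 : 0 ≤ (1 - t) * qform κ m0 m0 := mul_nonneg (by linarith) ih0
    have h2 : 0 ≤ t * qform κ m1 m1 := mul_nonneg ht0 ih1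
    have h3 : 0 ≤ (t ^ 2 - t) * qform κ (m1 - m0) (m1 - m0) :=
      mul_nonneg_of_nonpos_of_nonpos (by nlinarith) hneg
    linarith

/-- **Kernel rows, finite index type.**  For `μ = prodBernoulli p` on `Set ι` (`ι` finite), a monotone
statistic `λ : Set ι → Q` into a finite preorder, and a kernel `κ` with nonnegative diagonal that is
submodular on comparable rectangles: `0 ≤ Σ_{x,y} κ(x,y) μ(λ = x) μ(λ = y)`.  (With `Q` = set partitions of
marked vertices ordered by coarsening and `λ` = "partition into open clusters" this is a valid quadratic
row for every multi-point connectivity law of bond percolation on a finite weighted graph.) [new] -/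
theorem prodBernoulli_kernelRow [Finite ι] [DecidableEq Q] [Preorder Q] (p : ι → unitInterval)
    (hdiag : ∀ x, 0 ≤ κ x x)
    (hsub : ∀ a₀ a₁ b₀ b₁ : Q, a₀ ≤ a₁ → b₀ ≤ b₁ → κ a₁ b₁ + κ a₀ b₀ ≤ κ a₁ b₀ + κ a₀ b₁)
    (lam : Set ι → Q) (hmono : ∀ ⦃ω ω' : Set ι⦄, ω ⊆ ω' → lam ω ≤ lam ω') :
    0 ≤ ∑ x, ∑ y, κ x y * ((prodBernoulli p).real (lam ⁻¹' {x}) * (prodBernoulli p).real (lam ⁻¹' {y})) := by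
  classical
  haveI := Fintype.ofFinite ι
  have hall : ∀ X : Set (Set ι), DeterminedBy X (↑(Finset.univ : Finset ι) : Set ι) := fun X => by
    rw [determinedBy_iff]; intro ω ω' h; simp only [Finset.coe_univ, Set.inter_univ] at h; rw [h]
  exact prodBernoulli_kernelRow_of_determinedBy κ p hdiag hsub Finset.univ lam hmono
    fun q => hall _

end KernelRows

end Summit.CriticalPhenomena.PercolationContinuityZ3.Theorems
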